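import Literature.MathematicalPhysics.QuantumLattice.HubbardRectangularTorus
import Literature.MathematicalPhysics.QuantumLattice.InfVolFermionState
import HarnessLib
import HarnessLib.Audit

/-!
# Many-body bootstrap — Bounds: certified ground-state energy and correlator bounds for Hubbard / Heisenberg
# lattice models (statement level), part `Defs`

Cell pub-mbboot (bundle `papers/HubbardSuperconductivity/manybody-bootstrap/`, HOME `run/shared/lean/pub/pub-mbboot/`).
HONEST FRAMING: certified numerical bounds on a lattice model; not superconductivity, not a phase diagram.

This directory (`Summits/HubbardSuperconductivity/ManyBodyBootstrap/Bounds/`) is the in-tree form of the cell's staged module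
`HOME/lean/HubbardCertifiedBounds.lean` (generated and audited by the cell's typer/referee lineage from the certificate index
`HOME/certs/sdp1/index.json` and the E2 / adv-1 certificate files; every row's docstring carries the certificate file name, its
sha256, the producing job and the verifiers), split into parts of ≤ 400 lines by the cell's literature seat (tool
`file_parts_g19.py`; unit→part table and shas in HOME/PLACEMENT.md). The parts are:

* `Defs` (this file): `E₀ a b t U N` = `groundEnergyAt (fermionRectTorusGraph a b) t U N` (the `a × b` Hubbard torus of the tree,
  a side of length 2 is ONE bond; all `S^z`), the two-sided predicate `CertifiedBound a b t U N lo hi := lo ≤ E₀ ≤ hi`, and the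
  window annihilation operators `cNN` / `cNNN` on the supports `{0, e₁, e₂}` / `{0, e₁+e₂, e₁−e₂} ⊆ ℤ²` in which the
  thermodynamic-limit spin-correlation rows are stated;
* `EDTorusRows`: engineer-2 exact-diagonalisation two-sided enclosures `ed_bounds_<a>x<b>_U<U>` (format `mbboot-e2-cert-v1`:
  per `(N↑,N↓)` sector an exact integer sparse matrix, UPPER = exact integer Rayleigh quotient of a rounded eigenvector, LOWER =
  dyadic shift with an exact integer residual of a rounded Cholesky factor; cross-verified by a code-independent implementation),
  plus ONE kernel-checked row `e0_2x2_U2_N4_le` linking the `2×2` torus to the tree's plaquette theorems;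
* `SdpRows1–4`: engineer-1 moment-matrix (bootstrap SDP) certificates, format `certsdp/1` (`HOME/certs/FORMAT-certsdp1.md`), in the
  order of `index.json`: sector-mode lower bounds `sdp_lower_*` on `E₀(N)` of rings and 2D tori (Hubbard) and of Heisenberg rings /
  tori, reduce-mode (translation + point group) thermodynamic-limit rows `sdp_lower_TL_*`, two-sided thermodynamic-limit
  CORRELATOR rows `sdp_corr_TL_*` (double occupancy `D`, nearest / next-nearest-neighbour spin correlation `S`/`N`, kinetic
  energy `K`, each as a lower `…lo` or upper `…up` row) and finite-torus sector-correlator rows `sdp_corr_sector_*`; the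
  identity "Hamiltonian − E·1 = SOS + multipliers + residual" is re-derived from each file in exact arithmetic by two
  independent verifiers (A, B; a third, code-independent one for the rows so marked), and the step identity ⇒ bound is a
  PROVED tree theorem named in every docstring (`groundEnergyAt_ge_of_certificate(_charged/_residual)`,
  `energyDensity2D_ge_of_window_certificate_d4`, `HubbardCorrelatorCertificate(Affine)`, `HubbardSectorCorrelatorCertificate`, …;
  abstract duality `Literature/MathematicalPhysics/QuantumLattice/BootstrapCertificateDuality.lean`, Han arXiv:2006.06002 §2–3);
* `Corollaries1–5`, `OneHoleUpperRows`: kernel-checked consequences of the rows (energy-density ceilings from concavity in `U`,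
  kinetic-energy brackets `k = e − U·D`, Shen–Qiu–Tian sign companions, Tian charge-gap ≥ spin-gap ceilings, Lieb–Mattis spin-gap
  identification, two-sided `4×4` brackets, the staggered-structure bracket) and the one-hole (`N = 15`) integer Rayleigh-quotient
  upper rows `ed_upper_*` that make the gap ceilings unconditional. These sections are theorem-only apart from the `ed_upper_*`
  claim nodes; "zero admits" throughout.

CONVENTIONS (as in the sibling topic `HubbardLadder/Bounds`): every certificate-backed statement is a CLAIM NODE
`@[conjecture] def <row> : Prop := <exact rational inequality against the tree Hamiltonian>` — an open obligation node, closable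
in-kernel by importing the certificate's exact data (done for the `2×2` plaquette elsewhere in the tree), NOT a vendored fact and not
a published citation; its docstring ends with `[computation: <format>, exact ℚ]`. Nothing in these files asserts a claim node:
corollaries take the rows they use as hypotheses `(h : <row>)` or are stated on the claim nodes by name. Declarations are
byte-identical to the staged module except for the namespace (`Summit.HubbardSuperconductivity.Bounds` →
`Summit.HubbardSuperconductivity.ManyBodyBootstrap.Bounds`), the `@[conjecture]` attribute, the `[computation: …]` tag, and
docstrings added to six membership lemmas below. Landed tree files are append-only: later certificate rows arrive as further
parts `SdpRows5`, … filed the same way.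
-/

noncomputable section

namespace Summit.HubbardSuperconductivity.ManyBodyBootstrap.Bounds

open Literature.MathematicalPhysics.QuantumLattice
open Literature.Probability.LatticeModels
open HubbardWave0


/-- Ground-state energy of the Hubbard model on the `a × b` torus (`fermionRectTorusGraph a b`; side `2` = one
bond), hopping `t`, on-site `U`, `N` particles (all `S^z`). -/
def E₀ (a b : ℕ) (t U : ℚ) (N : ℕ) : ℝ := groundEnergyAt (fermionRectTorusGraph a b) (t : ℝ) (U : ℝ) N

/-- Certificate-backed two-sided bound `lo ≤ E₀ ≤ hi`. -/
def CertifiedBound (a b : ℕ) (t U : ℚ) (N : ℕ) (lo hi : ℚ) : Prop :=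
  (lo : ℝ) ≤ E₀ a b t U N ∧ E₀ a b t U N ≤ (hi : ℝ)

/-- gen-99: the support `{0, e₁, e₂} ⊆ ℤ²` of the nearest-neighbour spin-correlation objective (`unitVec 0 = e₁`, `unitVec 1 = e₂`). -/
abbrev nnSupport : Finset (Site 2) := {0, unitVec 0, unitVec 1}

/-- `0 ∈ nnSupport` (membership proof used to build `cNN 0`). -/
theorem zero_mem_nnSupport : (0 : Site 2) ∈ nnSupport := Finset.mem_insert_self _ _
/-- `e₁ = unitVec 0 ∈ nnSupport` (membership proof used to build `cNN 1`). -/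
theorem e1_mem_nnSupport : unitVec 0 ∈ nnSupport := Finset.mem_insert_of_mem (Finset.mem_insert_self _ _)
/-- `e₂ = unitVec 1 ∈ nnSupport` (membership proof used to build `cNN 2`). -/
theorem e2_mem_nnSupport : unitVec 1 ∈ nnSupport :=
  Finset.mem_insert_of_mem (Finset.mem_insert_of_mem (Finset.mem_singleton_self _))

/-- gen-99: the annihilation operators `c_{xσ} ∈ 𝔄_{nnSupport}` at `x = 0` (`i = 0`), `x = e₁` (`i = 1`), `x = e₂` (`i = 2`); `σ = 0` is ↑, `σ = 1` is ↓. -/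
noncomputable abbrev cNN (i : Fin 3) (σ : Fin 2) : FermionOp nnSupport :=
  match i with
  | 0 => cAt 0 zero_mem_nnSupport σ
  | 1 => cAt (unitVec 0) e1_mem_nnSupport σ
  | 2 => cAt (unitVec 1) e2_mem_nnSupport σ

/-- gen-100: the support `{0, e₁+e₂, e₁−e₂} ⊆ ℤ²` of the DIAGONAL (next-nearest-neighbour) spin-correlation objective `spin_nnn`. -/
abbrev nnnSupport : Finset (Site 2) := {0, unitVec 0 + unitVec 1, unitVec 0 - unitVec 1}

/-- `0 ∈ nnnSupport` (membership proof used to build `cNNN 0`). -/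
theorem zero_mem_nnnSupport : (0 : Site 2) ∈ nnnSupport := Finset.mem_insert_self _ _
/-- `e₁ + e₂ ∈ nnnSupport` (membership proof used to build `cNNN 1`). -/
theorem e1pe2_mem_nnnSupport : unitVec 0 + unitVec 1 ∈ nnnSupport := Finset.mem_insert_of_mem (Finset.mem_insert_self _ _)
/-- `e₁ − e₂ ∈ nnnSupport` (membership proof used to build `cNNN 2`). -/
theorem e1me2_mem_nnnSupport : unitVec 0 - unitVec 1 ∈ nnnSupport :=
  Finset.mem_insert_of_mem (Finset.mem_insert_of_mem (Finset.mem_singleton_self _))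

/-- gen-100: the annihilation operators `c_{xσ} ∈ 𝔄_{nnnSupport}` at `x = 0` (`i = 0`), `x = e₁+e₂` (`i = 1`), `x = e₁−e₂` (`i = 2`); `σ = 0` is ↑, `σ = 1` is ↓. -/
noncomputable abbrev cNNN (i : Fin 3) (σ : Fin 2) : FermionOp nnnSupport :=
  match i with
  | 0 => cAt 0 zero_mem_nnnSupport σ
  | 1 => cAt (unitVec 0 + unitVec 1) e1pe2_mem_nnnSupport σ
  | 2 => cAt (unitVec 0 - unitVec 1) e1me2_mem_nnnSupport σ

end Summit.HubbardSuperconductivity.ManyBodyBootstrap.Bounds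

end
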